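/-
Copyright (c) 2026. All rights reserved.
Released under Apache 2.0 license as described in the file LICENSE.
Authors: abc-iut cell, seat abc-iut-w5-d024 (gen 5).
-/
import Literature.GroupTheory.ProfiniteSchurZassenhaus
import Literature.GroupTheory.ProfiniteSchurZassenhausConjugacy

/-!
# The profinite Schur–Zassenhaus theorem: conjugacy of closed complements, general coprime case

Let `G` be a profinite group and `P ⊴ G` a closed normal subgroup of "order prime to its index"
levelwise: in every finite continuous quotient `G ⧸ V` the image `P̄_V` of `P` has order prime to its
index.  This file removes the `p`-primary restriction of
`Literature.GroupTheory.exists_conj_eq_of_closed_isComplement'` (file `ProfiniteSchurZassenhausConjugacy.lean`):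

* `isComplement'_map_mk'_of_isComplement'_of_coprime` — a CLOSED complement `C` of `P` is a complement
  levelwise (`|C̄_V| = [G : P(C ∩ V)]` divides `[G ⧸ V″ : P̄_{V″}]` for an open normal `V″ ≤ V`, which is
  prime to `|P̄_{V″}|`, a multiple of `|P̄_V|`);
* `exists_conj_eq_of_closed_isComplement'_of_levelwise_conj` — closed complements are conjugate as soon
  as complements of `P̄_V` are conjugate in every `G ⧸ V` (compactness);
* **`exists_conj_eq_of_closed_isComplement'_of_isSolvable_quotient`** — hence closed complements of `P`
  are conjugate whenever the finite quotients `(G ⧸ V) ⧸ P̄_V` are SOLVABLE (e.g. `G ⧸ P` prosolvable),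
  by the finite Schur–Zassenhaus theorem in the "quotient solvable" case (tree:
  `Literature.GroupTheory.Solvable.exists_conj_eq_of_isComplement'_of_isSolvable_quotient`);
* **`exists_conj_eq_of_closed_isComplement'_of_isSolvable`** — and whenever the `P̄_V` are solvable
  (e.g. `P` prosolvable; the `p`-primary case being `P` pro-`p`).

[cite: RibesZalesskii2010, Thm 2.3.15]; conjugacy theorems in universe `0` (that of the tree's finite
theorems).  Classical; no definitions; nothing here concerns [IUTchIII] Cor. 3.12.
-/

open scoped Pointwise

namespace Literature.GroupTheory

open Subgroup

/-! ### Closed complements are complements levelwise (general coprime case) -/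

section Levelwise

universe u

variable {G : Type u} [Group G] [TopologicalSpace G] [IsTopologicalGroup G] [CompactSpace G]
  [TotallyDisconnectedSpace G]

omit [IsTopologicalGroup G] [CompactSpace G] [TotallyDisconnectedSpace G] in
/-- The index of the image of `P` in `G ⧸ V` is `[G : P V]`. [folklore] -/
private theorem index_map_mk'_eq (P : Subgroup G) (V : OpenNormalSubgroup G) :
    (P.map (QuotientGroup.mk' (V : Subgroup G))).index = (P ⊔ (V : Subgroup G)).index := by
  rw [Subgroup.index_map, QuotientGroup.ker_mk',
    MonoidHom.range_eq_top.mpr (QuotientGroup.mk'_surjective _), Subgroup.index_top, mul_one]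

omit [IsTopologicalGroup G] [CompactSpace G] [TotallyDisconnectedSpace G] in
/-- `|P̄_V|` divides `|P̄_{V″}|` for `V″ ≤ V`. [folklore] -/
private theorem card_map_mk'_dvd_of_le (P : Subgroup G) {V'' V : OpenNormalSubgroup G} (hle : V'' ≤ V) :
    Nat.card (P.map (QuotientGroup.mk' (V : Subgroup G))) ∣
      Nat.card (P.map (QuotientGroup.mk' (V'' : Subgroup G))) := by
  have hle' : (V'' : Subgroup G) ≤ (V : Subgroup G).comap (MonoidHom.id G) := by
    rw [Subgroup.comap_id]; exact fun _ hx => hle hx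
  let f : G ⧸ (V'' : Subgroup G) →* G ⧸ (V : Subgroup G) :=
    QuotientGroup.map (V'' : Subgroup G) (V : Subgroup G) (MonoidHom.id G) hle'
  have hcomp : f.comp (QuotientGroup.mk' (V'' : Subgroup G)) = QuotientGroup.mk' (V : Subgroup G) :=
    MonoidHom.ext fun x => QuotientGroup.map_mk' _ _ _ hle' x
  have : P.map (QuotientGroup.mk' (V : Subgroup G)) =
      (P.map (QuotientGroup.mk' (V'' : Subgroup G))).map f := by
    rw [Subgroup.map_map, hcomp]
  rw [this]
  exact Subgroup.card_map_dvd _ f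

/-- **A closed complement is a complement levelwise (general coprime case).** Let `G` be profinite,
`P ⊴ G` closed with `|P̄_V|` prime to `[G ⧸ V : P̄_V]` for every open normal `V`, and `C` a closed
complement of `P`. Then `C̄_V` is a complement of `P̄_V` in every `G ⧸ V`.
[cite: RibesZalesskii2010, Thm 2.3.15] -/
theorem isComplement'_map_mk'_of_isComplement'_of_coprime (P : Subgroup G) [P.Normal]
    (hPc : IsClosed (P : Set G))
    (hcop : ∀ V : OpenNormalSubgroup G,
      Nat.Coprime (Nat.card (P.map (QuotientGroup.mk' (V : Subgroup G))))
        (P.map (QuotientGroup.mk' (V : Subgroup G))).index)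
    {C : Subgroup G} (hCc : IsClosed (C : Set G)) (hPC : IsComplement' P C)
    (V : OpenNormalSubgroup G) :
    IsComplement' (P.map (QuotientGroup.mk' (V : Subgroup G)))
      (C.map (QuotientGroup.mk' (V : Subgroup G))) := by
  classical
  haveI : Finite (G ⧸ (V : Subgroup G)) := inferInstance
  haveI hPn : (P.map (QuotientGroup.mk' (V : Subgroup G))).Normal :=
    Subgroup.Normal.map inferInstance _ (QuotientGroup.mk'_surjective _)
  -- `D = C ∩ V`, `U = P D`, `|C̄_V| = [G : U]`
  set D : Subgroup G := C ⊓ (V : Subgroup G) with hD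
  set U : Subgroup G := P ⊔ D with hU
  have hidx : D.relIndex C = U.index := relIndex_eq_index_sup_of_isComplement' P C hPC inf_le_left
  have hcardC : Nat.card (C.map (QuotientGroup.mk' (V : Subgroup G))) = U.index := by
    rw [← Subgroup.relIndex_ker, QuotientGroup.ker_mk', ← Subgroup.inf_relIndex_left, hidx]
  have hUne : U.index ≠ 0 := by
    rw [← hidx, hD, Subgroup.inf_relIndex_left]
    intro h0
    have hdvd := Subgroup.relIndex_dvd_index_of_normal (V : Subgroup G) C
    rw [h0, zero_dvd_iff] at hdvd
    exact Subgroup.index_ne_zero_of_finite hdvd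
  haveI : U.FiniteIndex := ⟨hUne⟩
  have hDc : IsClosed (D : Set G) := by
    rw [hD, Subgroup.coe_inf]
    exact hCc.inter V.toOpenSubgroup.isClosed
  have hUc : IsClosed (U : Set G) := by
    rw [hU, Subgroup.normal_mul]
    exact (hPc.isCompact.mul hDc.isCompact).isClosed
  have hUo : IsOpen (U : Set G) := Subgroup.isOpen_of_isClosed_of_finiteIndex U hUc
  -- an open normal `V″ ≤ V` inside `U`
  obtain ⟨V₀, hV₀⟩ := ProfiniteGrp.exist_openNormalSubgroup_sub_open_nhds_of_one hUo (one_mem U)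
  set V'' : OpenNormalSubgroup G := V₀ ⊓ V with hV''
  have hV''U : ((V'' : Subgroup G) : Set G) ⊆ U := fun x hx =>
    hV₀ ((inf_le_left : V₀ ⊓ V ≤ V₀) hx)
  have hle : P ⊔ (V'' : Subgroup G) ≤ U := sup_le le_sup_left fun x hx => hV''U hx
  -- `[G : U] ∣ [G ⧸ V″ : P̄_{V″}]`, which is prime to `|P̄_{V″}|`, a multiple of `|P̄_V|`
  have hcopU : Nat.Coprime (Nat.card (P.map (QuotientGroup.mk' (V : Subgroup G)))) U.index := by
    have h1 : U.index ∣ (P.map (QuotientGroup.mk' (V'' : Subgroup G))).index := by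
      rw [index_map_mk'_eq]
      exact Subgroup.index_dvd_of_le hle
    have h2 := card_map_mk'_dvd_of_le P (inf_le_right : V₀ ⊓ V ≤ V)
    exact ((hcop V'').coprime_dvd_left h2).coprime_dvd_right h1
  have hdis : Disjoint (P.map (QuotientGroup.mk' (V : Subgroup G)))
      (C.map (QuotientGroup.mk' (V : Subgroup G))) := by
    refine Subgroup.disjoint_of_coprime_natCard ?_
    rw [hcardC]
    exact hcopU
  have hsup : P.map (QuotientGroup.mk' (V : Subgroup G)) ⊔ C.map (QuotientGroup.mk' (V : Subgroup G))
      = ⊤ := by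
    rw [← Subgroup.map_sup, hPC.sup_eq_top]
    exact Subgroup.map_top_of_surjective _ (QuotientGroup.mk'_surjective _)
  refine isComplement'_of_disjoint_and_mul_eq_univ hdis ?_
  rw [← Subgroup.normal_mul, hsup, Subgroup.coe_top]

end Levelwise

/-! ### Conjugacy from levelwise conjugacy -/

section Conjugacy

variable {G : Type} [Group G] [TopologicalSpace G] [IsTopologicalGroup G] [CompactSpace G]
  [TotallyDisconnectedSpace G]

omit [TopologicalSpace G] [IsTopologicalGroup G] [CompactSpace G] [TotallyDisconnectedSpace G] in
/-- Conjugating a complement of a normal subgroup gives a complement. [folklore] -/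
private theorem isComplement'_map_conj' (P : Subgroup G) [hPn : P.Normal] {C : Subgroup G}
    (hPC : IsComplement' P C) (x : G) : IsComplement' P (C.map (MulAut.conj x).toMonoidHom) := by
  have hP : P.map (MulAut.conj x).toMonoidHom = P := by
    ext y
    constructor
    · rintro ⟨z, hz, rfl⟩
      exact hPn.conj_mem z hz x
    · intro hy
      refine ⟨x⁻¹ * y * x⁻¹⁻¹, hPn.conj_mem y hy x⁻¹, ?_⟩
      simp [MulAut.conj_apply, mul_assoc]
  have hinj : Function.Injective (MulAut.conj x).toMonoidHom := fun a b h => (MulAut.conj x).injective h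
  have hsurj : Function.Surjective (MulAut.conj x).toMonoidHom := fun b => (MulAut.conj x).surjective b
  have hdis : Disjoint P (C.map (MulAut.conj x).toMonoidHom) := by
    rw [disjoint_iff]
    conv_lhs => rw [← hP]
    rw [← Subgroup.map_inf_eq _ _ _ hinj, disjoint_iff.mp hPC.disjoint, Subgroup.map_bot]
  have hsup : P ⊔ C.map (MulAut.conj x).toMonoidHom = ⊤ := by
    conv_lhs => rw [← hP]
    rw [← Subgroup.map_sup, hPC.sup_eq_top]
    exact Subgroup.map_top_of_surjective _ hsurj
  refine isComplement'_of_disjoint_and_mul_eq_univ hdis ?_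
  rw [← Subgroup.normal_mul, hsup, Subgroup.coe_top]

/-- In a profinite group, an element lying in `C′ V` for every open normal `V` lies in the closed
subgroup `C′`. [folklore] -/
private theorem mem_of_forall_mem_sup' {C' : Subgroup G}
    (hC'c : IsClosed (C' : Set G)) {y : G}
    (hy : ∀ V : OpenNormalSubgroup G, y ∈ C' ⊔ (V : Subgroup G)) : y ∈ C' := by
  by_contra hyC
  have hO : IsOpen {w : G | y * w ∈ (C' : Set G)ᶜ} :=
    hC'c.isOpen_compl.preimage (continuous_const.mul continuous_id)
  obtain ⟨W, hW⟩ := ProfiniteGrp.exist_openNormalSubgroup_sub_open_nhds_of_one hO (by simpa using hyC)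
  have hyW : y ∈ ((C' ⊔ (W : Subgroup G) : Subgroup G) : Set G) := hy W
  rw [Subgroup.mul_normal] at hyW
  obtain ⟨c, hc, w, hw, hcw⟩ := Set.mem_mul.mp hyW
  have hw' : w⁻¹ ∈ (W : Subgroup G) := inv_mem hw
  have := hW hw'
  simp only [Set.mem_setOf_eq, Set.mem_compl_iff, SetLike.mem_coe] at this
  apply this
  rw [← hcw, mul_inv_cancel_right]
  exact hc

/-- **Conjugacy of closed complements from levelwise conjugacy.** Let `G` be profinite, `P ⊴ G` closed
with levelwise coprime order and index, and suppose that in every finite continuous quotient `G ⧸ V`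
any two complements of `P̄_V` are conjugate. Then any two CLOSED complements of `P` in `G` are
conjugate (compactness: the closed nonempty sets `{x | x C x⁻¹ ⊆ C′ V}` are directed in `V`).
[cite: RibesZalesskii2010, Thm 2.3.15] -/
theorem exists_conj_eq_of_closed_isComplement'_of_levelwise_conj (P : Subgroup G) [P.Normal]
    (hPc : IsClosed (P : Set G))
    (hcop : ∀ V : OpenNormalSubgroup G,
      Nat.Coprime (Nat.card (P.map (QuotientGroup.mk' (V : Subgroup G))))
        (P.map (QuotientGroup.mk' (V : Subgroup G))).index)
    (hconj : ∀ (V : OpenNormalSubgroup G) (Q₁ Q₂ : Subgroup (G ⧸ (V : Subgroup G))),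
      IsComplement' (P.map (QuotientGroup.mk' (V : Subgroup G))) Q₁ →
      IsComplement' (P.map (QuotientGroup.mk' (V : Subgroup G))) Q₂ →
        ∃ g : G ⧸ (V : Subgroup G), Q₂ = Q₁.map (MulAut.conj g).toMonoidHom)
    {C C' : Subgroup G} (hCc : IsClosed (C : Set G)) (hC'c : IsClosed (C' : Set G))
    (hPC : IsComplement' P C) (hPC' : IsComplement' P C') :
    ∃ x : G, C' = C.map (MulAut.conj x).toMonoidHom := by
  classical
  haveI : Nonempty (OpenNormalSubgroup G) :=
    ⟨{ toOpenSubgroup := ⊤, isNormal' := by change (⊤ : Subgroup G).Normal; infer_instance }⟩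
  let T : OpenNormalSubgroup G → Set G :=
    fun V => {x : G | ∀ c ∈ C, x * c * x⁻¹ ∈ C' ⊔ (V : Subgroup G)}
  have hTc : ∀ V, IsClosed (T V) := by
    intro V
    have hopen : IsOpen (((C' ⊔ (V : Subgroup G) : Subgroup G)) : Set G) :=
      Subgroup.isOpen_mono le_sup_right V.toOpenSubgroup.isOpen
    have hclosed : IsClosed (((C' ⊔ (V : Subgroup G) : Subgroup G)) : Set G) :=
      OpenSubgroup.isClosed ⟨_, hopen⟩
    have : T V = ⋂ c ∈ C, (fun x : G => x * c * x⁻¹) ⁻¹' ((C' ⊔ (V : Subgroup G) : Subgroup G) : Set G) := by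
      ext x; simp [T]
    rw [this]
    exact isClosed_biInter fun c _ => hclosed.preimage (by fun_prop)
  have hTne : ∀ V, (T V).Nonempty := by
    intro V
    have h₁ := isComplement'_map_mk'_of_isComplement'_of_coprime P hPc hcop hCc hPC V
    have h₂ := isComplement'_map_mk'_of_isComplement'_of_coprime P hPc hcop hC'c hPC' V
    obtain ⟨g, hg⟩ := hconj V _ _ h₁ h₂
    obtain ⟨x, rfl⟩ := QuotientGroup.mk'_surjective (V : Subgroup G) g
    refine ⟨x, fun c hc => ?_⟩
    have hmem : QuotientGroup.mk' (V : Subgroup G) (x * c * x⁻¹) ∈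
        C'.map (QuotientGroup.mk' (V : Subgroup G)) := by
      rw [hg, map_mul, map_mul, map_inv]
      exact Subgroup.mem_map_of_mem (MulAut.conj (QuotientGroup.mk' (V : Subgroup G) x)).toMonoidHom
        (Subgroup.mem_map_of_mem _ hc)
    have := Subgroup.mem_comap.mpr hmem
    rw [Subgroup.comap_map_eq, QuotientGroup.ker_mk'] at this
    exact this
  have hTdir : Directed (· ⊇ ·) T := by
    intro V₁ V₂
    refine ⟨V₁ ⊓ V₂, fun x hx c hc => ?_, fun x hx c hc => ?_⟩
    · exact (sup_le_sup_left (show ((V₁ ⊓ V₂ : OpenNormalSubgroup G) : Subgroup G) ≤ (V₁ : Subgroup G)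
        from fun y hy => (inf_le_left : V₁ ⊓ V₂ ≤ V₁) hy) C') (hx c hc)
    · exact (sup_le_sup_left (show ((V₁ ⊓ V₂ : OpenNormalSubgroup G) : Subgroup G) ≤ (V₂ : Subgroup G)
        from fun y hy => (inf_le_right : V₁ ⊓ V₂ ≤ V₂) hy) C') (hx c hc)
  obtain ⟨x, hx⟩ := IsCompact.nonempty_iInter_of_directed_nonempty_isCompact_isClosed T hTdir hTne
    (fun V => (hTc V).isCompact) hTc
  rw [Set.mem_iInter] at hx
  refine ⟨x, (eq_of_le_of_isComplement' P (isComplement'_map_conj' P hPC x) hPC' ?_).symm⟩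
  rintro _ ⟨c, hc, rfl⟩
  exact mem_of_forall_mem_sup' hC'c fun V => by simpa using hx V c hc

/-- **Profinite Schur–Zassenhaus conjugacy, prosolvable-quotient case.** Let `G` be profinite and
`P ⊴ G` closed with levelwise coprime order and index, such that the finite quotients
`(G ⧸ V) ⧸ P̄_V` are solvable (e.g. `G ⧸ P` prosolvable). Then any two closed complements of `P` are
conjugate. [cite: RibesZalesskii2010, Thm 2.3.15] -/
theorem exists_conj_eq_of_closed_isComplement'_of_isSolvable_quotient (P : Subgroup G) [P.Normal]
    (hPc : IsClosed (P : Set G))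
    (hcop : ∀ V : OpenNormalSubgroup G,
      Nat.Coprime (Nat.card (P.map (QuotientGroup.mk' (V : Subgroup G))))
        (P.map (QuotientGroup.mk' (V : Subgroup G))).index)
    (hsolv : ∀ V : OpenNormalSubgroup G,
      haveI : (P.map (QuotientGroup.mk' (V : Subgroup G))).Normal :=
        Subgroup.Normal.map inferInstance _ (QuotientGroup.mk'_surjective _)
      IsSolvable ((G ⧸ (V : Subgroup G)) ⧸ P.map (QuotientGroup.mk' (V : Subgroup G))))
    {C C' : Subgroup G} (hCc : IsClosed (C : Set G)) (hC'c : IsClosed (C' : Set G))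
    (hPC : IsComplement' P C) (hPC' : IsComplement' P C') :
    ∃ x : G, C' = C.map (MulAut.conj x).toMonoidHom := by
  classical
  refine exists_conj_eq_of_closed_isComplement'_of_levelwise_conj P hPc hcop (fun V Q₁ Q₂ h₁ h₂ => ?_)
    hCc hC'c hPC hPC'
  haveI : Finite (G ⧸ (V : Subgroup G)) := inferInstance
  haveI hKn : (P.map (QuotientGroup.mk' (V : Subgroup G))).Normal :=
    Subgroup.Normal.map inferInstance _ (QuotientGroup.mk'_surjective _)
  haveI := hsolv V
  exact Solvable.exists_conj_eq_of_isComplement'_of_isSolvable_quotient _ (hcop V) h₁.symm h₂.symm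

/-- **Profinite Schur–Zassenhaus conjugacy, prosolvable-kernel case.** Let `G` be profinite and
`P ⊴ G` closed with levelwise coprime order and index, such that the images `P̄_V` are solvable (e.g.
`P` prosolvable, in particular pro-`p`). Then any two closed complements of `P` are conjugate.
[cite: RibesZalesskii2010, Thm 2.3.15] -/
theorem exists_conj_eq_of_closed_isComplement'_of_isSolvable (P : Subgroup G) [P.Normal]
    (hPc : IsClosed (P : Set G))
    (hcop : ∀ V : OpenNormalSubgroup G,
      Nat.Coprime (Nat.card (P.map (QuotientGroup.mk' (V : Subgroup G))))
        (P.map (QuotientGroup.mk' (V : Subgroup G))).index)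
    (hsolv : ∀ V : OpenNormalSubgroup G, IsSolvable (P.map (QuotientGroup.mk' (V : Subgroup G))))
    {C C' : Subgroup G} (hCc : IsClosed (C : Set G)) (hC'c : IsClosed (C' : Set G))
    (hPC : IsComplement' P C) (hPC' : IsComplement' P C') :
    ∃ x : G, C' = C.map (MulAut.conj x).toMonoidHom := by
  classical
  refine exists_conj_eq_of_closed_isComplement'_of_levelwise_conj P hPc hcop (fun V Q₁ Q₂ h₁ h₂ => ?_)
    hCc hC'c hPC hPC'
  haveI : Finite (G ⧸ (V : Subgroup G)) := inferInstance
  haveI hKn : (P.map (QuotientGroup.mk' (V : Subgroup G))).Normal :=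
    Subgroup.Normal.map inferInstance _ (QuotientGroup.mk'_surjective _)
  haveI := hsolv V
  exact Solvable.exists_conj_eq_of_isComplement'_of_isSolvable _ (hcop V) h₁.symm h₂.symm

end Conjugacy

end Literature.GroupTheory
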